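import Mathlib
import Summits.Ventures.PercRepro2.CoinKSureGate
import Summits.Ventures.PercRepro2.CoinKSureAD
import Summits.Ventures.PercRepro2.CoinChainAWorldGenLemmas
import Summits.Ventures.PercRepro2.CoinChainBlindLemmas

/-!
# The GENERAL AND-switch chain with head-blind non-entries — the lifted law
(blind cell PercRepro2, night-2 g20; proofs/NIGHT2-DARC.md §60.8)

The general chain of §56.1: `a` entered from `ent ⊆ U` by SURE coins and from `a'` by the coin
`ρ`, `a'` entered from `ent' ⊆ U` surely; the κ-integrated pair `ν · chainMix ent ent' ρ c d`,
`ν · chainMix ent ent' ρ c d'` with `chainTheta ent ent' ρ W ∈ {1, ρ, 0}` (`W` meets `ent`; meets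
`ent'` only; neither).  HYPOTHESIS: the head is blind to the non-entries `U ∖ (ent ∪ ent')` —
`c W = c (W ∩ (ent ∪ ent'))` etc.

The lifted law on `insert x₀ U` (`liftLawG`): the coin bit `x₀` is `Ber(ρ)` on EVERY cluster;
the `on` side carries `ρ·e` (`e = d` for the `R`-law, `e = d'` for the gate), the `off` side
carries `offG` — `(1 − ρ)·e` on the clusters meeting `ent` (`a` surely entered there, so the
`off` side is entered too), `(1 − ρ)·c` on those meeting `ent'` only, `c − ρ·d` on the entry-free
ones.  It is an OR-tail pair with the SURE ENTRY SET `insert x₀ ent` — the sure entries of `a`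
stay entries on the lifted lattice (`liftLawG_lsm`, `liftLawG_cross`, `liftLawG_off`); summing
out `x₀` returns the chain values `chainMix ent ent' ρ c d` resp. the gate minus the entry-free
pivotal mass (`offG_add`).
-/

namespace Summit.Ventures.PercRepro2.Coin

open Classical

section ChainBlindGen

variable {V : Type*} [DecidableEq V] {R : Type*} [Field R] [LinearOrder R] [IsStrictOrderedRing R]

/-- The `off` weight of the lifted law of the general chain with head value `e` on the entered
side: `(1 − ρ)·e` on the clusters meeting `ent`, the pure `blindOff` elsewhere. -/
def offG (ent ent' : Finset V) (ρ : R) (c d e : Finset V → R) (W : Finset V) : R :=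
  if ∃ r ∈ ent, r ∈ W then (1 - ρ) * e W else blindOff ent' ρ c d W

omit [Field R] [LinearOrder R] [IsStrictOrderedRing R] in
/-- A cluster missing `ent` and `ent'` misses `ent ∪ ent'`. -/
lemma not_meets_union_of {ent ent' W : Finset V} (h₁ : ¬ ∃ r ∈ ent, r ∈ W)
    (h₂ : ¬ ∃ r ∈ ent', r ∈ W) : ¬ ∃ r ∈ ent ∪ ent', r ∈ W := fun ⟨r, hr, hrW⟩ => by
  rcases Finset.mem_union.1 hr with hr | hr
  · exact h₁ ⟨r, hr, hrW⟩
  · exact h₂ ⟨r, hr, hrW⟩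

omit [Field R] [LinearOrder R] [IsStrictOrderedRing R] in
/-- A cluster meets `ent ∪ ent'` iff it meets `ent` or `ent'`. -/
lemma meets_entUnion_iff {ent ent' W : Finset V} :
    (∃ r ∈ ent ∪ ent', r ∈ W) ↔ (∃ r ∈ ent, r ∈ W) ∨ (∃ r ∈ ent', r ∈ W) := by
  constructor
  · rintro ⟨r, hr, hrW⟩
    rcases Finset.mem_union.1 hr with hr | hr
    · exact Or.inl ⟨r, hr, hrW⟩
    · exact Or.inr ⟨r, hr, hrW⟩
  · rintro (⟨r, hr, hrW⟩ | ⟨r, hr, hrW⟩)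
    · exact ⟨r, Finset.mem_union_left _ hr, hrW⟩
    · exact ⟨r, Finset.mem_union_right _ hr, hrW⟩

/-- `offG` is nonnegative. -/
lemma offG_nonneg (ent ent' : Finset V) (ρ : R) (c d e : Finset V → R) (hρ0 : 0 ≤ ρ) (hρ1 : ρ ≤ 1)
    (hc0 : ∀ W, 0 ≤ c W) (hd0 : ∀ W, 0 ≤ d W) (he0 : ∀ W, 0 ≤ e W) (hdc : ∀ W, d W ≤ c W)
    (W : Finset V) : 0 ≤ offG ent ent' ρ c d e W := by
  unfold offG
  split_ifs
  · exact mul_nonneg (by linarith) (he0 W)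
  · exact blindOff_nonneg ent' ρ c d hρ0 hρ1 hc0 hd0 hdc W

/-- `offG` dominates `(1 − ρ)·e` everywhere (for `e ≤ c`). -/
lemma offG_ge (ent ent' : Finset V) (ρ : R) (c d e : Finset V → R) (hρ0 : 0 ≤ ρ) (hρ1 : ρ ≤ 1)
    (hdc : ∀ W, d W ≤ c W) (hec : ∀ W, e W ≤ c W) (W : Finset V) :
    (1 - ρ) * e W ≤ offG ent ent' ρ c d e W := by
  have h1ρ : 0 ≤ 1 - ρ := by linarith
  unfold offG blindOff
  split_ifs
  · exact le_rfl
  · exact mul_le_mul_of_nonneg_left (hec W) h1ρ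
  · exact le_trans (mul_le_mul_of_nonneg_left (hec W) h1ρ)
      (one_sub_mul_le_sub ρ (c W) (d W) hρ0 (hdc W))

omit [Field R] [LinearOrder R] [IsStrictOrderedRing R] in
/-- With blindness to `ent ∪ ent'`, an entry-free cluster carries the values at `∅`. -/
lemma blindG_empty (ent ent' : Finset V) (c : Finset V → R)
    (hbc : ∀ W, c W = c (W ∩ (ent ∪ ent'))) {W : Finset V} (h : ¬ ∃ r ∈ ent ∪ ent', r ∈ W) :
    c W = c ∅ := by rw [hbc W, inter_ent_eq_empty_of_not h]

omit [Field R] [LinearOrder R] [IsStrictOrderedRing R] in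
/-- With blindness to `ent ∪ ent'`, the head values do not see an entry-free cluster joined on. -/
lemma blindG_union_of_not (ent ent' : Finset V) (c : Finset V → R)
    (hbc : ∀ W, c W = c (W ∩ (ent ∪ ent'))) {s t : Finset V} (hs : ¬ ∃ r ∈ ent ∪ ent', r ∈ s) :
    c (s ∪ t) = c t :=
  blind_union_of_not (ent ∪ ent') c hbc hs

/-- **The cross inequality off `ent`**: `e s · blindOff t ≤ blindOff (s ∩ t) · e (s ∪ t)` for
`t` not meeting `ent` (blindness to `ent ∪ ent'`). -/
lemma blindOff_crossG (ent ent' : Finset V) (ρ : R) (c d e : Finset V → R) (hρ0 : 0 ≤ ρ) (hρ1 : ρ ≤ 1)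
    (he0 : ∀ W, 0 ≤ e W) (hdc : ∀ W, d W ≤ c W)
    (hce : ∀ s t, c s * e t ≤ c (s ∩ t) * e (s ∪ t))
    (hbc : ∀ W, c W = c (W ∩ (ent ∪ ent'))) (hbd : ∀ W, d W = d (W ∩ (ent ∪ ent')))
    (hbe : ∀ W, e W = e (W ∩ (ent ∪ ent'))) (s t : Finset V) (ht : ¬ ∃ r ∈ ent, r ∈ t) :
    e s * blindOff ent' ρ c d t ≤ blindOff ent' ρ c d (s ∩ t) * e (s ∪ t) := by
  have h1ρ : 0 ≤ 1 - ρ := by linarith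
  by_cases ht' : ∃ r ∈ ent', r ∈ t
  · have h0 : c t * e s ≤ c (s ∩ t) * e (s ∪ t) := by
      have := hce t s
      rwa [Finset.inter_comm, Finset.union_comm] at this
    by_cases hi' : ∃ r ∈ ent', r ∈ s ∩ t
    · unfold blindOff
      rw [if_pos ht', if_pos hi']
      calc e s * ((1 - ρ) * c t) = (1 - ρ) * (c t * e s) := by ring
        _ ≤ (1 - ρ) * (c (s ∩ t) * e (s ∪ t)) := mul_le_mul_of_nonneg_left h0 h1ρ
        _ = (1 - ρ) * c (s ∩ t) * e (s ∪ t) := by ring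
    · unfold blindOff
      rw [if_pos ht', if_neg hi']
      have h2 := one_sub_mul_le_sub ρ (c (s ∩ t)) (d (s ∩ t)) hρ0 (hdc _)
      calc e s * ((1 - ρ) * c t) = (1 - ρ) * (c t * e s) := by ring
        _ ≤ (1 - ρ) * (c (s ∩ t) * e (s ∪ t)) := mul_le_mul_of_nonneg_left h0 h1ρ
        _ = ((1 - ρ) * c (s ∩ t)) * e (s ∪ t) := by ring
        _ ≤ (c (s ∩ t) - ρ * d (s ∩ t)) * e (s ∪ t) := mul_le_mul_of_nonneg_right h2 (he0 _)
  · have htE : ¬ ∃ r ∈ ent ∪ ent', r ∈ t := not_meets_union_of ht ht'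
    have hi' : ¬ ∃ r ∈ ent', r ∈ s ∩ t := not_meets_inter_right ht'
    have hiE : ¬ ∃ r ∈ ent ∪ ent', r ∈ s ∩ t :=
      not_meets_union_of (not_meets_inter_right ht) hi'
    have e3 : e (s ∪ t) = e s := by
      rw [Finset.union_comm]; exact blindG_union_of_not ent ent' e hbe htE
    unfold blindOff
    rw [if_neg ht', if_neg hi', e3, blindG_empty ent ent' c hbc htE, blindG_empty ent ent' d hbd htE,
      blindG_empty ent ent' c hbc hiE, blindG_empty ent ent' d hbd hiE]
    ring_nf; exact le_rfl

/-- **The general cross inequality** `e s · offG^f t ≤ offG^f (s ∩ t) · e (s ∪ t)` for head values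
`e, f ≤ c` with `f s · e t ≤ f (s ∩ t) · e (s ∪ t)` (`(e, f) = (d, d), (d', d'), (d', d)`). -/
lemma offG_cross (ent ent' : Finset V) (ρ : R) (c d e f : Finset V → R) (hρ0 : 0 ≤ ρ) (hρ1 : ρ ≤ 1)
    (he0 : ∀ W, 0 ≤ e W) (hdc : ∀ W, d W ≤ c W) (hfc : ∀ W, f W ≤ c W)
    (hce : ∀ s t, c s * e t ≤ c (s ∩ t) * e (s ∪ t))
    (hfe : ∀ s t, f s * e t ≤ f (s ∩ t) * e (s ∪ t))
    (hbc : ∀ W, c W = c (W ∩ (ent ∪ ent'))) (hbd : ∀ W, d W = d (W ∩ (ent ∪ ent')))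
    (hbe : ∀ W, e W = e (W ∩ (ent ∪ ent'))) (s t : Finset V) :
    e s * offG ent ent' ρ c d f t ≤ offG ent ent' ρ c d f (s ∩ t) * e (s ∪ t) := by
  have h1ρ : 0 ≤ 1 - ρ := by linarith
  by_cases ht : ∃ r ∈ ent, r ∈ t
  · have h0 : f t * e s ≤ f (s ∩ t) * e (s ∪ t) := by
      have := hfe t s
      rwa [Finset.inter_comm, Finset.union_comm] at this
    have hge := offG_ge ent ent' ρ c d f hρ0 hρ1 hdc hfc (s ∩ t)
    have hT : offG ent ent' ρ c d f t = (1 - ρ) * f t := by unfold offG; rw [if_pos ht]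
    rw [hT]
    calc e s * ((1 - ρ) * f t) = (1 - ρ) * (f t * e s) := by ring
      _ ≤ (1 - ρ) * (f (s ∩ t) * e (s ∪ t)) := mul_le_mul_of_nonneg_left h0 h1ρ
      _ = ((1 - ρ) * f (s ∩ t)) * e (s ∪ t) := by ring
      _ ≤ offG ent ent' ρ c d f (s ∩ t) * e (s ∪ t) := mul_le_mul_of_nonneg_right hge (he0 _)
  · have hi : ¬ ∃ r ∈ ent, r ∈ s ∩ t := not_meets_inter_right ht
    unfold offG
    rw [if_neg ht, if_neg hi]
    exact blindOff_crossG ent ent' ρ c d e hρ0 hρ1 he0 hdc hce hbc hbd hbe s t ht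

omit [Field R] [LinearOrder R] [IsStrictOrderedRing R] in
/-- Erasing `ent` commutes with meets and joins. -/
lemma sdiff_inter_union (ent s t : Finset V) :
    (s ∩ t) \ ent = (s \ ent) ∩ (t \ ent) ∧ (s ∪ t) \ ent = (s \ ent) ∪ (t \ ent) := by
  constructor
  · ext v; simp only [Finset.mem_sdiff, Finset.mem_inter]; tauto
  · ext v; simp only [Finset.mem_sdiff, Finset.mem_union]; tauto

omit [Field R] [LinearOrder R] [IsStrictOrderedRing R] in
/-- The `ent`-erased head value is `ent'`-blind. -/
lemma erase_blind (ent ent' : Finset V) (c : Finset V → R)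
    (hbc : ∀ W, c W = c (W ∩ (ent ∪ ent'))) (W : Finset V) :
    c (W \ ent) = c ((W ∩ ent') \ ent) := by
  rw [hbc (W \ ent), hbc ((W ∩ ent') \ ent)]
  congr 1
  ext v; simp only [Finset.mem_inter, Finset.mem_sdiff, Finset.mem_union]; tauto

omit [Field R] [LinearOrder R] [IsStrictOrderedRing R] in
/-- On a cluster missing `ent` the `ent`-erased value is the value. -/
lemma erase_of_not (ent : Finset V) (c : Finset V → R) {W : Finset V} (h : ¬ ∃ r ∈ ent, r ∈ W) :
    c (W \ ent) = c W := by
  congr 1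
  ext v; simp only [Finset.mem_sdiff]
  exact ⟨fun h' => h'.1, fun hv => ⟨hv, fun hve => h ⟨v, hve, hv⟩⟩⟩

/-- **`blindOff` is log-supermodular on the clusters missing `ent`** (blindness to `ent ∪ ent'`),
by the pure lemma applied to the `ent`-erased head values. -/
lemma blindOff_lsm_of_not (ent ent' : Finset V) (ρ : R) (c d : Finset V → R) (hρ0 : 0 ≤ ρ) (hρ1 : ρ ≤ 1)
    (hc0 : ∀ W, 0 ≤ c W) (hdc : ∀ W, d W ≤ c W)
    (hcc : ∀ s t, c s * c t ≤ c (s ∩ t) * c (s ∪ t))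
    (hbc : ∀ W, c W = c (W ∩ (ent ∪ ent'))) (hbd : ∀ W, d W = d (W ∩ (ent ∪ ent')))
    {s t : Finset V} (hs : ¬ ∃ r ∈ ent, r ∈ s) (ht : ¬ ∃ r ∈ ent, r ∈ t) :
    blindOff ent' ρ c d s * blindOff ent' ρ c d t ≤
      blindOff ent' ρ c d (s ∩ t) * blindOff ent' ρ c d (s ∪ t) := by
  have hi : ¬ ∃ r ∈ ent, r ∈ s ∩ t := not_meets_inter_left hs
  have hu : ¬ ∃ r ∈ ent, r ∈ s ∪ t := fun h => by
    rcases meets_union_iff.1 h with h | h; exact hs h; exact ht h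
  have key := blindOff_lsm ent' ρ (fun W => c (W \ ent)) (fun W => d (W \ ent)) hρ0 hρ1
    (fun W => hc0 _) (fun W => hdc _)
    (fun s' t' => by
      obtain ⟨e1, e2⟩ := sdiff_inter_union ent s' t'
      show c (s' \ ent) * c (t' \ ent) ≤ c ((s' ∩ t') \ ent) * c ((s' ∪ t') \ ent)
      rw [e1, e2]; exact hcc _ _)
    (fun W => erase_blind ent ent' c hbc W) (fun W => erase_blind ent ent' d hbd W) s t
  have eq : ∀ {W : Finset V}, ¬ (∃ r ∈ ent, r ∈ W) →
      blindOff ent' ρ (fun W => c (W \ ent)) (fun W => d (W \ ent)) W = blindOff ent' ρ c d W :=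
    fun {W} h => by
      unfold blindOff
      simp only [erase_of_not ent c h, erase_of_not ent d h]
  rw [eq hs, eq ht, eq hi, eq hu] at key
  exact key

/-- **`offG` is log-supermodular** for a head value `e ≤ c` lsm, jointly lsm with `c`, blind. -/
lemma offG_lsm (ent ent' : Finset V) (ρ : R) (c d e : Finset V → R) (hρ0 : 0 ≤ ρ) (hρ1 : ρ ≤ 1)
    (hc0 : ∀ W, 0 ≤ c W) (he0 : ∀ W, 0 ≤ e W)
    (hdc : ∀ W, d W ≤ c W) (hec : ∀ W, e W ≤ c W)
    (hcc : ∀ s t, c s * c t ≤ c (s ∩ t) * c (s ∪ t))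
    (hee : ∀ s t, e s * e t ≤ e (s ∩ t) * e (s ∪ t))
    (hce : ∀ s t, c s * e t ≤ c (s ∩ t) * e (s ∪ t))
    (hbc : ∀ W, c W = c (W ∩ (ent ∪ ent'))) (hbd : ∀ W, d W = d (W ∩ (ent ∪ ent')))
    (hbe : ∀ W, e W = e (W ∩ (ent ∪ ent'))) (s t : Finset V) :
    offG ent ent' ρ c d e s * offG ent ent' ρ c d e t ≤
      offG ent ent' ρ c d e (s ∩ t) * offG ent ent' ρ c d e (s ∪ t) := by
  have h1ρ : 0 ≤ 1 - ρ := by linarith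
  by_cases hs : ∃ r ∈ ent, r ∈ s <;> by_cases ht : ∃ r ∈ ent, r ∈ t
  · have hu : ∃ r ∈ ent, r ∈ s ∪ t := meets_union_iff.2 (Or.inl hs)
    have hge := offG_ge ent ent' ρ c d e hρ0 hρ1 hdc hec (s ∩ t)
    have h1 := hee s t
    have h3 : 0 ≤ (1 - ρ) * e (s ∪ t) := mul_nonneg h1ρ (he0 _)
    have hS : offG ent ent' ρ c d e s = (1 - ρ) * e s := by unfold offG; rw [if_pos hs]
    have hT : offG ent ent' ρ c d e t = (1 - ρ) * e t := by unfold offG; rw [if_pos ht]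
    have hU : offG ent ent' ρ c d e (s ∪ t) = (1 - ρ) * e (s ∪ t) := by unfold offG; rw [if_pos hu]
    rw [hS, hT, hU]
    calc (1 - ρ) * e s * ((1 - ρ) * e t) = (1 - ρ) * (1 - ρ) * (e s * e t) := by ring
      _ ≤ (1 - ρ) * (1 - ρ) * (e (s ∩ t) * e (s ∪ t)) :=
          mul_le_mul_of_nonneg_left h1 (mul_nonneg h1ρ h1ρ)
      _ = ((1 - ρ) * e (s ∩ t)) * ((1 - ρ) * e (s ∪ t)) := by ring
      _ ≤ offG ent ent' ρ c d e (s ∩ t) * ((1 - ρ) * e (s ∪ t)) := mul_le_mul_of_nonneg_right hge h3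
  · have hi : ¬ ∃ r ∈ ent, r ∈ s ∩ t := not_meets_inter_right ht
    have hu : ∃ r ∈ ent, r ∈ s ∪ t := meets_union_iff.2 (Or.inl hs)
    have h2 := blindOff_crossG ent ent' ρ c d e hρ0 hρ1 he0 hdc hce hbc hbd hbe s t ht
    unfold offG
    rw [if_pos hs, if_neg ht, if_neg hi, if_pos hu]
    calc (1 - ρ) * e s * blindOff ent' ρ c d t = (1 - ρ) * (e s * blindOff ent' ρ c d t) := by ring
      _ ≤ (1 - ρ) * (blindOff ent' ρ c d (s ∩ t) * e (s ∪ t)) := mul_le_mul_of_nonneg_left h2 h1ρ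
      _ = blindOff ent' ρ c d (s ∩ t) * ((1 - ρ) * e (s ∪ t)) := by ring
  · have hi : ¬ ∃ r ∈ ent, r ∈ s ∩ t := not_meets_inter_left hs
    have hu : ∃ r ∈ ent, r ∈ s ∪ t := meets_union_iff.2 (Or.inr ht)
    have h2 := blindOff_crossG ent ent' ρ c d e hρ0 hρ1 he0 hdc hce hbc hbd hbe t s hs
    rw [Finset.inter_comm t, Finset.union_comm t] at h2
    unfold offG
    rw [if_neg hs, if_pos ht, if_neg hi, if_pos hu]
    calc blindOff ent' ρ c d s * ((1 - ρ) * e t) = (1 - ρ) * (e t * blindOff ent' ρ c d s) := by ring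
      _ ≤ (1 - ρ) * (blindOff ent' ρ c d (s ∩ t) * e (s ∪ t)) := mul_le_mul_of_nonneg_left h2 h1ρ
      _ = blindOff ent' ρ c d (s ∩ t) * ((1 - ρ) * e (s ∪ t)) := by ring
  · have hi : ¬ ∃ r ∈ ent, r ∈ s ∩ t := not_meets_inter_left hs
    have hu : ¬ ∃ r ∈ ent, r ∈ s ∪ t := fun h => by
      rcases meets_union_iff.1 h with h | h; exact hs h; exact ht h
    unfold offG
    rw [if_neg hs, if_neg ht, if_neg hi, if_neg hu]
    exact blindOff_lsm_of_not ent ent' ρ c d hρ0 hρ1 hc0 hdc hcc hbc hbd hs ht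

omit [LinearOrder R] [IsStrictOrderedRing R] in
/-- Summing the two lifted weights of a cluster gives the general chain value, plus the entry-free
pivotal correction `ρ·(e − d)` (zero for `e = d`). -/
lemma offG_add (ent ent' : Finset V) (ρ : R) (c d e : Finset V → R) (W : Finset V) :
    offG ent ent' ρ c d e W + ρ * e W =
      chainMix ent ent' ρ c e W +
        (if ∃ r ∈ ent ∪ ent', r ∈ W then (0 : R) else 1) * (ρ * (e W - d W)) := by
  unfold offG blindOff chainMix chainTheta
  by_cases hA : ∃ r ∈ ent, r ∈ W
  · rw [if_pos hA, if_pos hA, if_pos (meets_entUnion_iff.2 (Or.inl hA))]; ring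
  · by_cases hB : ∃ r ∈ ent', r ∈ W
    · rw [if_neg hA, if_neg hA, if_pos hB, if_pos hB, if_pos (meets_entUnion_iff.2 (Or.inr hB))]
      ring
    · rw [if_neg hA, if_neg hA, if_neg hB, if_neg hB, if_neg (not_meets_union_of hA hB)]; ring

end ChainBlindGen

end Summit.Ventures.PercRepro2.Coin
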